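import Mathlib
import HarnessLib
import Literature.MathematicalPhysics.StatisticalMechanics.TaylorPolynomialNorms
import Literature.MathematicalPhysics.StatisticalMechanics.TaylorPolynomialNormsPullback
import Literature.MathematicalPhysics.StatisticalMechanics.TaylorPolynomialNormsExpectation

/-!
# Weighted (large-field) norm bounds: submultiplicativity and boundedness of the Gaussian
# integration map (Adams–Buchholz–Kotecký–Müller, (6.47)–(6.49), Lemma 8.3, Lemma 8.4)

The WEAK NORM of a polymer activity in [ABKM19] is `‖K(X)‖_{k,X} = sup_φ |K(X)|_{k,X,T_φ} / w_k^X(φ)`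
((6.48); `w_k^X` the large-field weight of Ch. 7), and every estimate of Chs. 8–10 about it is an
inequality `|K(X)|_{k,X,T_φ} ≤ C · w(φ)` for all fields `φ`.  This file records that POINTWISE form as
a predicate, `TayNormLE T r₀ w K C` ("`‖K‖_{T,w} ≤ C`": `tayNorm T r₀ K φ ≤ C · w φ` for every `φ`),
for an arbitrary gauge `T` (`TaylorPolynomialNorms.lean`) and an arbitrary weight `w : E → ℝ`, and
proves the two structural facts of [ABKM19] Ch. 8.2–8.3 from HYPOTHESES on the weights (which
[ABKM19] Theorem 7.1 (w3)–(w7) supply for the specific weights of Ch. 7):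

* **`TayNormLE.mul`** (Lemma 8.3, submultiplicativity): if `‖K₁‖_{T₁,w₁} ≤ C₁`, `‖K₂‖_{T₂,w₂} ≤ C₂`
  with `Kᵢ` local for `Tᵢ`, the gauges `Tᵢ` are dominated by a common gauge `T`
  (`‖Tᵢ ξ‖ ≤ ‖T ξ‖`, e.g. `X_i^* ⊆ (X₁ ∪ X₂)^*`) and the weights FACTORISE, `w₁ w₂ ≤ w`
  (Theorem 7.1 (w3)–(w6)), then `‖K₁K₂‖_{T,w} ≤ C₁C₂` — by the product property of the Taylor norm
  (Prop. 13.9) and monotonicity in the gauge (Lemma 8.2); `TayNormLE.prod` is the version for a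
  finite product over components (Lemma 8.3 (i): `‖K(X)‖_{k,X} ≤ ∏_{Y ∈ 𝒞(X)} ‖K(Y)‖_{k,Y}`);
* **`TayNormLE.integral_comp_add`** (Lemma 8.4, `ℓ = 0`: the map `R_{k+1}K = ∫ K(· + ξ) μ_{k+1}(dξ)`
  is bounded): if `‖K‖_{T,w} ≤ C` and the weight has the INTEGRATION PROPERTY
  `∫ w(φ + ξ) μ(dξ) ≤ A · w'(φ)` (Theorem 7.1 (w7): `w = w_k^X`, `w' = w_{k:k+1}^X`, `A = A_𝒫^{|X|}`),
  then `‖R K‖_{T,w'} ≤ C·A`, under local domination of the derivatives ("Taylor expansion commutes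
  with convolution", `tayNorm_integral_comp_add_le`);
* bookkeeping: `TayNormLE.mono`, `.of_le_gauge`, `.add`, `norm_apply_le`.

Everything is proved; no named fact.  What is NOT here: the suprema themselves as real numbers /
the Banach spaces `(M(𝒫_k^c), ‖·‖_k^{(A)})` ((6.50)), and the weights of Ch. 7.

## References
* S. Adams, S. Buchholz, R. Kotecký, S. Müller, arXiv:1910.13564, Ch. 6.4 (6.47)–(6.49), Lemma 8.3,
  Lemma 8.4 [AdamsBuchholzKoteckyMuller2019].
-/

noncomputable section

namespace Literature.MathematicalPhysics.StatisticalMechanics.GradientRG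

open MeasureTheory Finset
open Literature.MathematicalPhysics.QuantumFieldTheory

variable {E V : Type*} [NormedAddCommGroup E] [NormedSpace ℝ E] [FiniteDimensional ℝ E]
  [NormedAddCommGroup V] [NormedSpace ℝ V]
  {𝔸 : Type*} [NormedRing 𝔸] [NormedAlgebra ℝ 𝔸]

/-- **`‖K‖_{T,w} ≤ C`** — the weighted weak-norm bound of [ABKM19] (6.48) in pointwise form:
`|K|_{T_φ} ≤ C · w(φ)` for every field `φ` (gauge `T`, Taylor order `r₀`, weight `w`).
[cite: AdamsBuchholzKoteckyMuller2019, Ch. 6.4 (6.48)] -/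
def TayNormLE (T : E →ₗ[ℝ] V) (r₀ : ℕ) (w : E → ℝ) (K : E → 𝔸) (C : ℝ) : Prop :=
  ∀ φ : E, tayNorm T r₀ K φ ≤ C * w φ

namespace TayNormLE

variable {T : E →ₗ[ℝ] V} {r₀ : ℕ} {w : E → ℝ} {K : E → 𝔸} {C : ℝ}

omit [FiniteDimensional ℝ E] in
/-- Weakening the constant. [cite: AdamsBuchholzKoteckyMuller2019, Ch. 6.4 (6.48)] -/
theorem mono (h : TayNormLE T r₀ w K C) {C' : ℝ} (hC : C ≤ C') (hw : ∀ φ, 0 ≤ w φ) :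
    TayNormLE T r₀ w K C' :=
  fun φ => (h φ).trans (mul_le_mul_of_nonneg_right hC (hw φ))

omit [FiniteDimensional ℝ E] in
/-- Weakening the weight ("the larger the weight function the weaker the norm", [ABKM19] Ch. 7.1).
[cite: AdamsBuchholzKoteckyMuller2019, Ch. 7.1 (discussion before (7.7))] -/
theorem mono_weight (h : TayNormLE T r₀ w K C) {w' : E → ℝ} (hC : 0 ≤ C) (hw : ∀ φ, w φ ≤ w' φ) :
    TayNormLE T r₀ w' K C :=
  fun φ => (h φ).trans (mul_le_mul_of_nonneg_left (hw φ) hC)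

omit [FiniteDimensional ℝ E] in
/-- The pointwise value is controlled: `‖K(φ)‖ ≤ C w(φ)` for a local `K` ([ABKM19] (8.2)).
[cite: AdamsBuchholzKoteckyMuller2019, Ch. 8.1 (8.2)] -/
theorem norm_apply_le (h : TayNormLE T r₀ w K C) (hloc : IsGaugeLocal T K) (φ : E) :
    ‖K φ‖ ≤ C * w φ :=
  (norm_apply_le_tayNorm r₀ hloc φ).trans (h φ)

/-- **Monotonicity in the gauge** (Lemma 8.2): a bound for the SMALLER gauge `T₁` (`‖T₁ξ‖ ≤ ‖Tξ‖`)
is a bound for `T`, for `T₁`-local `K`. [cite: AdamsBuchholzKoteckyMuller2019, Lemma 8.2] -/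
theorem of_le_gauge {V₁ : Type*} [NormedAddCommGroup V₁] [NormedSpace ℝ V₁] {T₁ : E →ₗ[ℝ] V₁}
    (h : TayNormLE T₁ r₀ w K C) (hle : ∀ ξ, ‖T₁ ξ‖ ≤ ‖T ξ‖) (hK : ContDiff ℝ r₀ K)
    (hloc : IsGaugeLocal T₁ K) : TayNormLE T r₀ w K C :=
  fun φ => (tayNorm_mono_gauge T T₁ hle hK hloc φ).trans (h φ)

/-- Subadditivity: `‖K₁ + K₂‖_{T,w} ≤ C₁ + C₂`. [cite: AdamsBuchholzKoteckyMuller2019, Ch. 6.4 (6.48)] -/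
theorem add {K₁ K₂ : E → 𝔸} {C₁ C₂ : ℝ} (h₁ : TayNormLE T r₀ w K₁ C₁) (h₂ : TayNormLE T r₀ w K₂ C₂)
    (hK₁ : ContDiff ℝ r₀ K₁) (hK₂ : ContDiff ℝ r₀ K₂) : TayNormLE T r₀ w (K₁ + K₂) (C₁ + C₂) := by
  intro φ
  refine (tayNorm_add_le T hK₁ hK₂ φ).trans ?_
  rw [add_mul]
  exact add_le_add (h₁ φ) (h₂ φ)

/-- **Submultiplicativity** ([ABKM19] Lemma 8.3): bounds `‖K₁‖_{T₁,w₁} ≤ C₁`, `‖K₂‖_{T₂,w₂} ≤ C₂` for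
`Tᵢ`-local `C^{r₀}` functionals, gauges dominated by `T` and FACTORISING weights `w₁ w₂ ≤ w`
(Theorem 7.1 (w3)–(w6)) give `‖K₁ K₂‖_{T,w} ≤ C₁ C₂`.
[cite: AdamsBuchholzKoteckyMuller2019, Lemma 8.3] -/
theorem mul {V₁ V₂ : Type*} [NormedAddCommGroup V₁] [NormedSpace ℝ V₁] [NormedAddCommGroup V₂]
    [NormedSpace ℝ V₂] {T₁ : E →ₗ[ℝ] V₁} {T₂ : E →ₗ[ℝ] V₂} {w₁ w₂ : E → ℝ} {K₁ K₂ : E → 𝔸}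
    {C₁ C₂ : ℝ} (h₁ : TayNormLE T₁ r₀ w₁ K₁ C₁) (h₂ : TayNormLE T₂ r₀ w₂ K₂ C₂)
    (hle₁ : ∀ ξ, ‖T₁ ξ‖ ≤ ‖T ξ‖) (hle₂ : ∀ ξ, ‖T₂ ξ‖ ≤ ‖T ξ‖)
    (hK₁ : ContDiff ℝ r₀ K₁) (hK₂ : ContDiff ℝ r₀ K₂) (hloc₁ : IsGaugeLocal T₁ K₁)
    (hloc₂ : IsGaugeLocal T₂ K₂) (hC₁ : 0 ≤ C₁) (hC₂ : 0 ≤ C₂)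
    (hw : ∀ φ, w₁ φ * w₂ φ ≤ w φ) :
    TayNormLE T r₀ w (K₁ * K₂) (C₁ * C₂) := by
  intro φ
  have hb₁ : tayNorm T r₀ K₁ φ ≤ C₁ * w₁ φ := (tayNorm_mono_gauge T T₁ hle₁ hK₁ hloc₁ φ).trans (h₁ φ)
  have hb₂ : tayNorm T r₀ K₂ φ ≤ C₂ * w₂ φ := (tayNorm_mono_gauge T T₂ hle₂ hK₂ hloc₂ φ).trans (h₂ φ)
  calc tayNorm T r₀ (K₁ * K₂) φ
      ≤ tayNorm T r₀ K₁ φ * tayNorm T r₀ K₂ φ := tayNorm_mul_le T hK₁ hK₂ φ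
    _ ≤ (C₁ * w₁ φ) * (C₂ * w₂ φ) :=
        mul_le_mul hb₁ hb₂ (tayNorm_nonneg _ _ _ _) ((tayNorm_nonneg _ _ _ _).trans hb₁)
    _ = (C₁ * C₂) * (w₁ φ * w₂ φ) := by ring
    _ ≤ (C₁ * C₂) * w φ := mul_le_mul_of_nonneg_left (hw φ) (mul_nonneg hC₁ hC₂)

/-- **Submultiplicativity over components** ([ABKM19] Lemma 8.3 (i):
`‖K(X)‖_{k,X} ≤ ∏_{Y ∈ 𝒞(X)} ‖K(Y)‖_{k,Y}` for a polymer activity that factors over the connected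
components `Y` of `X`, whose weights factorise): gauges `T_i` dominated by `T`, `T_i`-local `C^{r₀}`
factors with `‖K_i‖_{T_i,w_i} ≤ C_i`, `C_i ≥ 0` and `∏ w_i ≤ w` give `‖∏ K_i‖_{T,w} ≤ ∏ C_i`
(commutative values). [cite: AdamsBuchholzKoteckyMuller2019, Lemma 8.3 (i)] -/
theorem prod {ι : Type*} {𝔸' : Type*} [NormedCommRing 𝔸'] [NormedAlgebra ℝ 𝔸'] [NormOneClass 𝔸']
    {Vi : ι → Type*} [∀ i, NormedAddCommGroup (Vi i)] [∀ i, NormedSpace ℝ (Vi i)]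
    {Ti : ∀ i, E →ₗ[ℝ] Vi i} {wi : ι → E → ℝ} {Ki : ι → E → 𝔸'} {Ci : ι → ℝ} (s : Finset ι)
    (h : ∀ i ∈ s, TayNormLE (Ti i) r₀ (wi i) (Ki i) (Ci i)) (hle : ∀ i ∈ s, ∀ ξ, ‖Ti i ξ‖ ≤ ‖T ξ‖)
    (hK : ∀ i ∈ s, ContDiff ℝ r₀ (Ki i)) (hloc : ∀ i ∈ s, IsGaugeLocal (Ti i) (Ki i))
    (hC : ∀ i ∈ s, 0 ≤ Ci i) (hw : ∀ φ, ∏ i ∈ s, wi i φ ≤ w φ) :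
    TayNormLE T r₀ w (fun φ => ∏ i ∈ s, Ki i φ) (∏ i ∈ s, Ci i) := by
  intro φ
  have hb : ∀ i ∈ s, tayNorm T r₀ (Ki i) φ ≤ Ci i * wi i φ := fun i hi =>
    (tayNorm_mono_gauge T (Ti i) (hle i hi) (hK i hi) (hloc i hi) φ).trans (h i hi φ)
  calc tayNorm T r₀ (fun φ => ∏ i ∈ s, Ki i φ) φ
      ≤ ∏ i ∈ s, tayNorm T r₀ (Ki i) φ := tayNorm_prod_le T s hK φ
    _ ≤ ∏ i ∈ s, (Ci i * wi i φ) :=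
        Finset.prod_le_prod (fun i _ => tayNorm_nonneg _ _ _ _) hb
    _ = (∏ i ∈ s, Ci i) * ∏ i ∈ s, wi i φ := Finset.prod_mul_distrib
    _ ≤ (∏ i ∈ s, Ci i) * w φ :=
        mul_le_mul_of_nonneg_left (hw φ) (Finset.prod_nonneg hC)

omit [FiniteDimensional ℝ E] in
/-- **Boundedness of the Gaussian integration map** ([ABKM19] Lemma 8.4, `ℓ = 0`): if
`‖K‖_{T,w} ≤ C` (`C ≥ 0`) for a `T`-local `K`, the weight has the INTEGRATION PROPERTY
`∫ w(φ + ξ) μ(dξ) ≤ A · w'(φ)` (Theorem 7.1 (w7)) with `w(φ + ·)` integrable, and the derivatives of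
the lift are locally dominated, then `R K = ∫ K(· + ξ) μ(dξ)` obeys `‖R K‖_{T,w'} ≤ C · A`
("Since Taylor expansion commutes with convolution …", proof of Lemma 8.4).
[cite: AdamsBuchholzKoteckyMuller2019, Lemma 8.4] -/
theorem integral_comp_add [MeasurableSpace E] [CompleteSpace 𝔸] {μ : Measure E} {w' : E → ℝ}
    {A : ℝ} (h : TayNormLE T r₀ w K C) (hC : 0 ≤ C) (hloc : IsGaugeLocal T K)
    (hdom : DerivDominated r₀
      (fun (v : LinearMap.range T) (ξ : E) => gaugeLift T K (v + T.rangeRestrict ξ)) μ)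
    (hwint : ∀ φ, Integrable (fun ξ => w (φ + ξ)) μ)
    (hw : ∀ φ, ∫ ξ, w (φ + ξ) ∂μ ≤ A * w' φ) :
    TayNormLE T r₀ w' (fun ψ => ∫ ξ, K (ψ + ξ) ∂μ) (C * A) := by
  intro φ
  calc tayNorm T r₀ (fun ψ => ∫ ξ, K (ψ + ξ) ∂μ) φ
      ≤ ∫ ξ, tayNorm T r₀ K (φ + ξ) ∂μ := tayNorm_integral_comp_add_le hloc hdom φ
    _ ≤ ∫ ξ, C * w (φ + ξ) ∂μ :=
        integral_mono_of_nonneg (Filter.Eventually.of_forall fun ξ => tayNorm_nonneg _ _ _ _)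
          ((hwint φ).const_mul C) (Filter.Eventually.of_forall fun ξ => h (φ + ξ))
    _ = C * ∫ ξ, w (φ + ξ) ∂μ := integral_const_mul C _
    _ ≤ C * (A * w' φ) := mul_le_mul_of_nonneg_left (hw φ) hC
    _ = C * A * w' φ := by ring

end TayNormLE

end Literature.MathematicalPhysics.StatisticalMechanics.GradientRG

end
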